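import Mathlib.Algebra.Lie.SerreConstruction
import Mathlib.Algebra.Lie.Solvable
import Literature.NumberTheory.Automorphic.ReciprocityGLn
import Literature.NumberTheory.Automorphic.EssConjSelfDual
import Literature.NumberTheory.Automorphic.LieAlgebraGLBracket
import HarnessLib

/-!
# Dai 2025, Theorem 1.1 (`n = 7`): cofinite irreducibility of `ρ_{π,λ}` for regular algebraic
# essentially self-dual cuspidal `π` on `GL_7` over `ℚ` away from Lie type `G₂` (named fact)

Topic `NumberTheory/Automorphic`; namespace `Literature.NumberTheory.Automorphic`.

Source: B. Dai, *On irreducibility of certain low dimensional automorphic Galois representations*,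
arXiv:2510.12496 (Oct. 2025, unrefereed preprint) [Dai2025]; quotations from the held text
(`paper:arxiv-2510.12496`, p. 3 = §1, p. 4 = Def. 2.1/2.4, p. 6 = Thm. 2.9, p. 10 = Table 1).

> **§1, p. 3.** "For a `λ`-adic semisimple Galois representation `ρ : Gal_ℚ → GL_n(Ē_λ)`, the
> Zariski closure `𝐆` of its image inside `GL_{n,Ē_λ}` is a reductive group. Denote by
> `𝐆^der = [𝐆°, 𝐆°]` its derived subgroup, which is semisimple. Our main result is:
> **Theorem 1.1.** Let `{ρ_{π,λ} : Gal_ℚ → GL_n(Ē_λ)}_λ` be the `E`-rational strictly compatible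
> system of `ℚ` associated to a regular algebraic essentially self-dual cuspidal automorphic
> representation `π` of `GL_n(𝔸_ℚ)` where `n = 7` or `8`. Moreover we require:
> • If `n = 7`, there exists no `λ` such that tautological representation of `𝐆_λ^der` is the
>   standard representation of exceptional group `𝐆₂`. • If `n = 8`, [...].
> Then `ρ_{π,λ}` is irreducible for all but finitely many `λ`."
> **Thm. 2.9 ([BLGGT14]), p. 6** (the attached system): for `(π, χ)` regular algebraic cuspidal
> polarized on `GL_n(𝔸_F)`, `F` totally real or CM, there is a CM field `E` and an `E`-rational
> Serre compatible system `{ρ_{π,λ} : Gal_F → GL_n(Ē_λ)}` with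
> `ι WD(ρ_{π,λ}|_{Gal_{F_v}})^{F-ss} ≅ rec(π_v ⊗ |det|_v^{(1-n)/2})` for `v ∤ ℓ`.

Only the `n = 7` clause is vendored here (the `n = 8` clause carries an extra Hodge–Tate
arithmetic-progression proviso and is not needed by its consumer).

## The statement and its faithfulness

* `π`: cuspidal (`CuspidalAutomorphicRepData 7 ℚ hcpt`, `hcpt` threaded as in
  `exists_galoisRep_of_regularAlgebraic`, D-0014) and regular algebraic (`IsRegularAlgebraic`,
  Clozel), exactly as in the accepted `isIrreducible_galoisRep_gl3_totallyReal` (Böckle–Hui).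
* ESSENTIALLY SELF-DUAL = polarized in the sense of the source's standing reference [BLGGT14]
  §2.1 for the totally real field `F = ℚ`: a pair `(π, χ)` with `χ : 𝔸_ℚ^×/ℚ^× → ℂ^×` a continuous
  (Hecke) character and `π ≅ π^∨ ⊗ (χ ∘ det)`; the sign proviso of [BLGGT14] §2.1 for totally
  real fields ("`χ_v(-1)` independent of `v ∣ ∞`") is vacuous over `ℚ` (one infinite place).  The
  tree's accepted pairing form of `π^σ ≅ π^∨ ⊗ (χ ∘ det)` is `IsGalConjEssSelfDual π σ χ`
  (`EssConjSelfDual.lean`; "for `σ = 1` 'essentially self dual'"), taken here at `σ = 1`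
  (`AlgEquiv.refl`).
* THE ATTACHED REPRESENTATIONS.  As in `isIrreducible_galoisRep_gl3_totallyReal`, the tree does not
  single out `ρ_{π,λ}`: statements about it are phrased "for every prime `ℓ`, every
  `ι : ℚ̄_ℓ ≃+* ℂ` and every continuous SEMISIMPLE `r : Γ_ℚ →ₜ* GL_7(ℚ̄_ℓ)` which, at every finite
  `v ∤ ℓ` where `π` has Satake parameter `α`, is unramified with arithmetic-Frobenius
  characteristic polynomial `arithFrobPolyOfSatake ι q_v 7 α`" — the unramified part of the
  source's normalisation `rec(π_v ⊗ |det|_v^{(1-n)/2})` (Thm. 2.9 (ii)).  Such `r` are exactly the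
  representations equivalent to `ρ_{π,λ} ⊗_{Ē_λ} ℚ̄_ℓ` for the place `λ` of `E` under `ι⁻¹|_E`
  (Chebotarev + Brauer–Nesbitt, the tree's
  `FramedGaloisRep.nonempty_equiv_of_hasFrobCharpolyAt_eventually`), every `λ` arises from some
  `(ℓ, ι)`, and "all but finitely many `λ`" = "all `λ` above all but finitely many `ℓ`"; so the
  conclusion below (`∃ S : Finset ℕ, ∀ ℓ ∉ S, ∀ ι, ∀` such `r`, `r` irreducible) is the printed one
  transported along this standard identification.  Irreducible = `ContinuousRep.IsIrreducible`
  over the algebraically closed field `ℚ̄_ℓ` (= irreducible over `Ē_λ`, as printed).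
* THE `G₂` PROVISO.  For such an `r`, the algebraic monodromy group `𝐆` is the Zariski closure of
  `r(Γ_ℚ) ≤ GL_7(ℚ̄_ℓ)`, whose Lie algebra the tree provides as the Lie subalgebra
  `lieSubalgebraGL (range r) ⊆ 𝔤𝔩₇(ℚ̄_ℓ)` (`LieAlgebraGL.lean`, `LieAlgebraGLBracket.lean`; Springer
  4.1.3, 4.4.5).  In characteristic `0`, `Lie(𝐆^der) = Lie([𝐆°, 𝐆°]) = [𝔤, 𝔤]` for `𝔤 = Lie 𝐆`
  (standard; this is the Lie algebra `𝔤_λ := Lie(G_{ρ_λ}^{∘,der})` with its faithful `t_λ : 𝔤_λ ↪ 𝔤𝔩_n`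
  of Feng–Whitmore, arXiv:2507.22631 p. 4, who phrase the SAME excluded case as "`𝔤_{λ₀} ≅ 𝔤₂`,
  the exceptional rank `2` Lie algebra, with `t_{λ₀}` its unique `7`-dimensional irreducible
  representation", §1.3 p. 5), a connected semisimple group is determined up to central isogeny
  by its Lie algebra, `G₂` is both simply connected and adjoint, and the only faithful
  `7`-dimensional representation of the simple Lie algebra `𝔤₂` is its standard (irreducible) one
  (smallest non-trivial irreducible dimensions `7, 14, 27, …`).
  Hence "the tautological representation of `𝐆_λ^der` is the standard representation of `G₂`"
  ⟺ "the derived subalgebra `[𝔤, 𝔤]` (Mathlib `LieAlgebra.derivedSeries _ 𝔤 1`) is isomorphic,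
  as a Lie algebra over `ℚ̄_ℓ`, to the split exceptional Lie algebra `𝔤₂`" (Mathlib
  `LieAlgebra.g₂`, the Serre presentation on the Cartan matrix `G₂`; over an algebraically closed
  field of characteristic `0` this is the `14`-dimensional simple Lie algebra of type `G₂` by
  Serre's theorem).  The proviso is rendered as: NO `(ℓ, ι, r)` as above admits such an
  isomorphism (Lie type is invariant under equivalence of representations and under extension /
  automorphism of the algebraically closed coefficient field, so this is "no `λ`" as printed).
* Nothing else is added or dropped: `F = ℚ`, `n = 7`, every `ℓ ∉ S` and every `ι`.  The source is
  an arXiv preprint (v1, 2025-10); its `n = 7` argument is §3 Prop. 3.2 (induced case) + §4.1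
  (type `7A₁`) + §4.2 (type `7B₃`), resting on [Hui2023] Thm. 2.15/2.16 (= arXiv Thm. 1.2),
  [BarnetlambEtAl2014] Thm. C / 5.5.2, Calegari–Gee 2013 and Patrikis–Taylor 2015.

Consumers: route `Langlands/G2ShadowRankSeven` — crux `GenericWeightCofinite`
(`Summit.Langlands.Langlands.Theses.G2ShadowRankSeven.GenericWeightCofinite`: the item is this
fact composed with Sen's theorem "the Hodge–Tate cocharacter lies in `Lie 𝐆_λ`", which excludes
Lie type `G₂` off the `G₂`-admissible weight locus, plus the L- versus C-normalisation twist and the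
semisimplification bridge), crux `LineOrIrreducibleAdmissible` and target `RankSevenCofinite`
(= this fact with the proviso deleted).

## References

* [Dai2025] B. Dai, arXiv:2510.12496, Thm. 1.1 (p. 3), Def. 2.1/2.4 (p. 4), Thm. 2.9 (p. 6),
  Table 1 row (2) `7G₂` (p. 10).
* [BarnetlambEtAl2014] T. Barnet-Lamb, T. Gee, D. Geraghty, R. Taylor, Ann. of Math. 179 (2014),
  §2.1 (polarized), Thm. 2.1.1.
* [Hui2023] C. Y. Hui, J. Lond. Math. Soc. 108 (2023), Thm. 1.4 (`n ≤ 6`).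
-/

noncomputable section

open scoped NumberField
open NumberField IsDedekindDomain

namespace Literature.NumberTheory.Automorphic

/-- **Dai 2025, Theorem 1.1, case `n = 7` (cofinite irreducibility for `GL_7 / ℚ` away from Lie
type `G₂`).**  Let `π` be a regular algebraic cuspidal automorphic representation of `GL_7(𝔸_ℚ)`
which is essentially self-dual (`π ≅ π^∨ ⊗ (χ ∘ det)` for a Hecke character `χ` of `ℚ`, pairing
form `IsGalConjEssSelfDual π 1 χ`; = polarized, [BLGGT14] §2.1, the sign proviso being vacuous over
`ℚ`).  Suppose that for NO prime `ℓ`, `ι : ℚ̄_ℓ ≃+* ℂ` and continuous semisimple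
`r : Γ_ℚ →ₜ* GL_7(ℚ̄_ℓ)` attached to `(π, ι)` (unramified with arithmetic-Frobenius characteristic
polynomial `arithFrobPolyOfSatake ι q_v 7 α` at every finite `v ∤ ℓ` where `π` has Satake
parameter `α`) is the derived Lie algebra `[𝔤, 𝔤]` of `𝔤 = Lie` (Zariski closure of `r(Γ_ℚ)`)
isomorphic over `ℚ̄_ℓ` to the exceptional Lie algebra `𝔤₂` (⟺ printed: "there exists no `λ` such
that the tautological representation of `𝐆_λ^der` is the standard representation of `G₂`",
module docstring).  Then there is a finite set `S` of primes such that for every prime `ℓ ∉ S`,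
every `ι` and every such attached semisimple `r`, `r` is irreducible — printed: "Then `ρ_{π,λ}`
is irreducible for all but finitely many `λ`."  Grounds
`Summit.Langlands.Langlands.Theses.G2ShadowRankSeven.GenericWeightCofinite` (fact ∘ Sen's theorem)
and is the printed form of that route's target minus its `G₂` exception.  Named fact (D-0014),
from an unrefereed 2025 preprint; `hcpt` threaded. [cite: Dai2025, Thm. 1.1 (n = 7), with Thm. 2.9 and Table 1 (2)]
[cite: BarnetlambEtAl2014, §2.1 (polarized) and Thm. 2.1.1] -/
def Dai2025_isIrreducible_cofinite_gl7_rat_of_not_lieTypeG2 : Prop :=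
  ∀ (hcpt : isCompact_glFiniteIntegralLevel 7 ℚ) (π : CuspidalAutomorphicRepData 7 ℚ hcpt),
    π.1.IsRegularAlgebraic →
    (∃ χ : GaloisRepresentations.HeckeCharacter ℚ,
        π.1.IsGalConjEssSelfDual (AlgEquiv.refl : ℚ ≃ₐ[ℚ] ℚ) χ) →
    (∀ (ℓ : ℕ) [Fact ℓ.Prime] (ι : PadicAlgCl ℓ ≃+* ℂ)
        (r : GaloisRepresentations.FramedGaloisRep ℚ (PadicAlgCl ℓ) 7), r.toGaloisRep.IsSemisimple →
        (∀ (v : HeightOneSpectrum (𝓞 ℚ)) (α : Multiset ℂ), π.1.HasSatakeParamAt v α →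
            ((ℓ : ℕ) : 𝓞 ℚ) ∉ v.asIdeal →
              r.IsUnramifiedAt v ∧ r.HasFrobCharpolyAt v (arithFrobPolyOfSatake ι v.residueCard 7 α)) →
        IsEmpty
          (LieAlgebra.derivedSeries (PadicAlgCl ℓ) (lieSubalgebraGL (MonoidHom.range r.toMonoidHom)) 1
            ≃ₗ⁅PadicAlgCl ℓ⁆ LieAlgebra.g₂ (PadicAlgCl ℓ))) →
    ∃ S : Finset ℕ, ∀ (ℓ : ℕ) [Fact ℓ.Prime], ℓ ∉ S → ∀ (ι : PadicAlgCl ℓ ≃+* ℂ)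
        (r : GaloisRepresentations.FramedGaloisRep ℚ (PadicAlgCl ℓ) 7), r.toGaloisRep.IsSemisimple →
        (∀ (v : HeightOneSpectrum (𝓞 ℚ)) (α : Multiset ℂ), π.1.HasSatakeParamAt v α →
            ((ℓ : ℕ) : 𝓞 ℚ) ∉ v.asIdeal →
              r.IsUnramifiedAt v ∧ r.HasFrobCharpolyAt v (arithFrobPolyOfSatake ι v.residueCard 7 α)) →
        r.toGaloisRep.IsIrreducible

/-- Unfolding lemma (definitional). [folklore] -/
theorem Dai2025_isIrreducible_cofinite_gl7_rat_of_not_lieTypeG2_iff :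
    Dai2025_isIrreducible_cofinite_gl7_rat_of_not_lieTypeG2 ↔
      ∀ (hcpt : isCompact_glFiniteIntegralLevel 7 ℚ) (π : CuspidalAutomorphicRepData 7 ℚ hcpt),
        π.1.IsRegularAlgebraic →
        (∃ χ : GaloisRepresentations.HeckeCharacter ℚ,
            π.1.IsGalConjEssSelfDual (AlgEquiv.refl : ℚ ≃ₐ[ℚ] ℚ) χ) →
        (∀ (ℓ : ℕ) [Fact ℓ.Prime] (ι : PadicAlgCl ℓ ≃+* ℂ)
            (r : GaloisRepresentations.FramedGaloisRep ℚ (PadicAlgCl ℓ) 7),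
            r.toGaloisRep.IsSemisimple →
            (∀ (v : HeightOneSpectrum (𝓞 ℚ)) (α : Multiset ℂ), π.1.HasSatakeParamAt v α →
                ((ℓ : ℕ) : 𝓞 ℚ) ∉ v.asIdeal →
                  r.IsUnramifiedAt v ∧
                    r.HasFrobCharpolyAt v (arithFrobPolyOfSatake ι v.residueCard 7 α)) →
            IsEmpty
              (LieAlgebra.derivedSeries (PadicAlgCl ℓ)
                  (lieSubalgebraGL (MonoidHom.range r.toMonoidHom)) 1
                ≃ₗ⁅PadicAlgCl ℓ⁆ LieAlgebra.g₂ (PadicAlgCl ℓ))) →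
        ∃ S : Finset ℕ, ∀ (ℓ : ℕ) [Fact ℓ.Prime], ℓ ∉ S → ∀ (ι : PadicAlgCl ℓ ≃+* ℂ)
            (r : GaloisRepresentations.FramedGaloisRep ℚ (PadicAlgCl ℓ) 7),
            r.toGaloisRep.IsSemisimple →
            (∀ (v : HeightOneSpectrum (𝓞 ℚ)) (α : Multiset ℂ), π.1.HasSatakeParamAt v α →
                ((ℓ : ℕ) : 𝓞 ℚ) ∉ v.asIdeal →
                  r.IsUnramifiedAt v ∧
                    r.HasFrobCharpolyAt v (arithFrobPolyOfSatake ι v.residueCard 7 α)) →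
            r.toGaloisRep.IsIrreducible :=
  Iff.rfl

end Literature.NumberTheory.Automorphic
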